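/-
Copyright: seat `ym-line-sll-p3` (prover-ym-line-sll-p3-g0-0), route `SoftLoopLongLag`, crux `SoftLoopLagFloorToTorus`
(stmt-QuantumFields-22504), line `birth` (skeleton `Cruxes/SoftLoopLagFloorToTorus/Lines/birth.lean`).
-/
import Summits.QuantumFields.YangMills.Theorems.SoftLoopLongLagSoftLoopLagFloorToTorusDlrTransferPlumbingG

/-!
# Registered stub K1 `stub_dlrTransferG` of crux `SoftLoopLagFloorToTorus` (stmt-QuantumFields-22504), line `birth` —
# part 2 of 3: the torus lag covariance through the box kernels (DLR), the bad boundary data of the lag box, and the inner step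
# (one boundary datum whose kernel is cold-typical)

WHAT (every compact group `G`, `r : LatticeRep G`; objects of `Theorems/SoftLoopLongLagDefs.lean`, plumbing of part 1
`…DlrTransferPlumbingG`):
* §4 `torusLagCov_eq_boxKernel` — for torus sides `L + 1 > 2(n + 6R + 2)` the torus lag covariance `torusLagCov r β L F_R R` equals
  `∫ q − ∫ h · ∫ k` with `h, k, q` the box-kernel (`ymSpecification r.ρ β (lagBox n) ·`) means of `F_R`, `F_R∘α_R`, `F_R·F_R∘α_R` at the
  periodic lift: the DLR equations of the torus Wilson state (`wilsonExpectation_toTorusObservable_eq`; Georgii 2011 Thm. 4.17,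
  Friedli–Velenik 2017 Lemma 6.7, (6.34)) — the lag box is centred, so no translation step is needed;
* §5 the bad boundary data `Bad = ⋃_{p touching Λ_n} {β^{2δ−1} < c_p}` (measurable; off it the lifted datum is `CrudeGoodCorona`), of
  torus mass `≤ 16(2n+3)⁴e^{−β^δ}` by the union bound over the plaquettes touching `Λ_n` (`measureReal_badSet_lagBox_le`), uniformly in `L`;
* §6 `boxKernel_lagCov_ge_of_coldTypical` — the inner step: if the kernel `γ_η` charges the hot event by `≤ e ≤ 1/2`, the cold floor
  `θ₀ ≤ Cov_ν` and the smoothness `|ν(F_R∘α_R) − ν(F_R)| ≤ ε₀` of the cold-conditioned kernel `ν` lift to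
  `(1−e)θ₀ − 5B²e ≤ Cov_γ(F_R, F_R∘α_R)` and `|γ(F_R∘α_R) − γ(F_R)| ≤ ε₀ + 2Be`, `B = (2R+1)⁴` (part 1 §1 with `A = cold`).

WHAT THIS IS NOT.  No analysis: floor, smoothness and typicality are hypotheses.  HONEST LABEL: rung R2xi-G RECORD label (leaf
`WeakCouplingRates.XiPow`, an UPPER bound on the lattice mass gap); NOT the Clay mass gap; no summit statement is touched.

References: H.-O. Georgii, *Gibbs Measures and Phase Transitions* (2011) Thm. 4.17; S. Friedli, Y. Velenik (2017) Lemma 6.7, (6.34);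
R. Durrett (2019) §4.1; E. Seiler, LNP 159 (1982) Ch. 2.
-/

set_option autoImplicit false

noncomputable section

open MeasureTheory Filter Topology
open Literature.Probability.LatticeModels (Site box mem_box box_mono)
open Literature.MathematicalPhysics Literature.MathematicalPhysics.QuantumFieldTheory
open Literature.MathematicalPhysics.QuantumLattice
open Summit.QuantumFields.YangMills.Theorems.WeakCouplingRates
open Summit.QuantumFields.YangMills.Theorems.ColdBoxAllGroups (measurable_plaqCostAtG measureReal_setOf_le_plaqCostAt_eqG)

namespace Summit.QuantumFields.YangMills.Theorems.SoftLoopLongLag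

/-! ### §4. The torus lag covariance through the box kernels (the DLR equations) -/

section Torus

variable {G : Type} [Group G] [TopologicalSpace G] [IsTopologicalGroup G] [CompactSpace G]
  [MeasurableSpace G] [BorelSpace G]

/-- **The torus lag covariance through the box kernels**, any compact `G`.  For torus sides `L + 1 > 2(n + 6R + 2)` (the lag box
`Λ_n` with its collar and the supports of `F_R`, `F_R ∘ α_R` fit the fundamental domain), `torusLagCov r β L F_R R = ∫ q − ∫ h · ∫ k`
with `h, k, q` the box-kernel (`ymSpecification r.ρ β (lagBox n) ·`) means of `F_R`, `F_R ∘ α_R`, `F_R · F_R ∘ α_R` evaluated at the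
periodic lift of the torus configuration: the DLR equations of the torus Wilson state (Georgii 2011 Thm. 4.17; Friedli–Velenik 2017
Lemma 6.7, (6.34); tree `wilsonExpectation_toTorusObservable_eq`). [folklore] -/
theorem torusLagCov_eq_boxKernel (r : LatticeRep G) (β : ℝ) {n R L : ℕ} (hL : 2 * (n + 6 * R + 2) < L + 1) :
    torusLagCov r β L (softLoopObs r R) R =
      (∫ U, (∫ W, softLoopObs r R W * softLoopObs r R (timeShiftLG (G := G) R W)
            ∂(ymSpecification (d := 4) r.ρ β (lagBox n) (torusLift (L + 1) U)))
          ∂(wilsonMeasure (d := 4) (L := L + 1) r.ρ β)) -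
        (∫ U, (∫ W, softLoopObs r R W ∂(ymSpecification (d := 4) r.ρ β (lagBox n) (torusLift (L + 1) U)))
          ∂(wilsonMeasure (d := 4) (L := L + 1) r.ρ β)) *
        (∫ U, (∫ W, softLoopObs r R (timeShiftLG (G := G) R W)
            ∂(ymSpecification (d := 4) r.ρ β (lagBox n) (torusLift (L + 1) U)))
          ∂(wilsonMeasure (d := 4) (L := L + 1) r.ρ β)) := by
  haveI : SecondCountableTopology G := r.secondCountableTopology
  set Λ : Finset (QuantumLattice.ZdEdge 4) := lagBox n with hΛ
  set F : LGConfig 4 G → ℝ := softLoopObs r R with hF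
  obtain ⟨S, hFS, hS⟩ := exists_support_softLoopObs r R
  -- supports and the torus fit
  set S₀ : Finset (QuantumLattice.ZdEdge 4) := S ∪ S.image fun e => (e.1 + Pi.single 0 (R : ℤ), e.2) with hS₀
  have hcyl : IsCylinder F S₀ := hFS.mono (Finset.coe_subset.2 Finset.subset_union_left)
  have hcyl' : IsCylinder (fun U => F (timeShiftLG (G := G) R U)) S₀ :=
    (isCylinder_timeShift hFS R).mono (Finset.coe_subset.2 Finset.subset_union_right)
  have hcylq : IsCylinder (fun U => F U * F (timeShiftLG (G := G) R U)) S₀ := by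
    have h := IsCylinder.mul hFS (isCylinder_timeShift hFS R)
    exact h
  have hS₀box : ∀ e ∈ S₀, e.1 ∈ box 4 (n + 6 * R + 2) := by
    intro e he
    rcases Finset.mem_union.1 he with he | he
    · exact box_mono 4 (by omega) (hS e he)
    · exact box_mono 4 (by omega) (fst_mem_box_of_mem_image_shift hS he)
  have hT : ∀ e ∈ Λ ∪ S₀ ∪ (plaquettesTouching Λ).biUnion plaquetteEdges, e.1 ∈ box 4 (n + 6 * R + 2) := by
    intro e he
    rcases Finset.mem_union.1 he with he | he
    · rcases Finset.mem_union.1 he with he | he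
      · exact box_mono 4 (by omega) (fst_mem_box_of_mem_lagBox_union_collar (Finset.mem_union_left _ he))
      · exact hS₀box e he
    · exact box_mono 4 (by omega) (fst_mem_box_of_mem_lagBox_union_collar (Finset.mem_union_right _ he))
  have hinj := injOn_torusProj_image_fst hL hT
  -- the three DLR identities
  have hFc : Continuous F := continuous_softLoopObs r R
  have hFc' : Continuous fun U => F (timeShiftLG (G := G) R U) := hFc.comp (continuous_timeShiftLG R)
  have hqc : Continuous fun U => F U * F (timeShiftLG (G := G) R U) := hFc.mul hFc'
  have hFK : ∀ U, |F U| ≤ (2 * (R : ℝ) + 1) ^ 4 := abs_softLoopObs_le' r R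
  have hFK' : ∀ U, |F (timeShiftLG (G := G) R U)| ≤ (2 * (R : ℝ) + 1) ^ 4 := fun U => abs_softLoopObs_le' r R _
  have hqK : ∀ U, |F U * F (timeShiftLG (G := G) R U)| ≤ ((2 * (R : ℝ) + 1) ^ 4) ^ 2 := abs_softLoopObs_mul_le r R R
  have dlr : ∀ {Φ : LGConfig 4 G → ℝ}, Continuous Φ → ∀ {C : ℝ}, (∀ U, |Φ U| ≤ C) → IsCylinder Φ S₀ →
      ∫ U, Φ (torusLift (L + 1) U) ∂(wilsonMeasure (d := 4) (L := L + 1) r.ρ β) =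
        ∫ U, (∫ W, Φ W ∂(ymSpecification r.ρ β Λ (torusLift (L + 1) U)))
          ∂(wilsonMeasure (d := 4) (L := L + 1) r.ρ β) := by
    intro Φ hΦ C hC hΦS
    have h := wilsonExpectation_toTorusObservable_eq r.ρ r.continuous β Λ hΦ hC hΦS (L := L + 1) hinj
    simpa only [wilsonExpectation, toTorusObservable, Function.comp_def] using h
  unfold torusLagCov wilsonExpectation
  simp only [toTorusObservable_apply]
  rw [dlr hqc hqK hcylq, dlr hFc hFK hcyl, dlr hFc' hFK' hcyl']

end Torus

/-! ### §5. The bad boundary data of the lag box: a finite union of single-plaquette large-field events -/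

section Bad

variable {G : Type} [Group G] [TopologicalSpace G] [IsTopologicalGroup G] [CompactSpace G]
  [MeasurableSpace G] [BorelSpace G]

omit [IsTopologicalGroup G] [CompactSpace G] [MeasurableSpace G] [BorelSpace G] in
/-- Off the bad set the datum is crude-good for the lag box (`CrudeGoodCorona`). [folklore] -/
theorem crudeGoodCorona_of_not_mem_badSet (r : LatticeRep G) {β δ : ℝ} {n : ℕ} {W : LGConfig 4 G}
    (hW : W ∉ ⋃ p ∈ plaquettesTouching (lagBox n),
      {W : LGConfig 4 G | β ^ (2 * δ - 1) < plaqCostAt r.ρ p.1 p.2.1.1 p.2.1.2 W}) :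
    CrudeGoodCorona r β δ n W := by
  intro p hp
  by_contra hlt
  rw [not_le] at hlt
  exact hW (Set.mem_iUnion₂.2 ⟨p, hp, hlt⟩)

omit [CompactSpace G] in
/-- The bad set of the lag box is measurable. [folklore] -/
theorem measurableSet_badSet_lagBox [SecondCountableTopology G] (r : LatticeRep G) (β δ : ℝ) (n : ℕ) :
    MeasurableSet (⋃ p ∈ plaquettesTouching (lagBox n),
      {W : LGConfig 4 G | β ^ (2 * δ - 1) < plaqCostAt r.ρ p.1 p.2.1.1 p.2.1.2 W}) :=
  Finset.measurableSet_biUnion _ fun p _ =>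
    measurableSet_lt measurable_const (measurable_plaqCostAtG r.ρ r.continuous p.1 p.2.1.1 p.2.1.2)

/-- **Union bound for the bad set of the lag box.** If every single-plaquette large-field indicator has Wilson expectation
`≤ e^{−β^δ}` on the torus `(L+1)⁴` (the body of `PlaquetteLargeFieldRarityG r.ρ δ` at this `β` and `L`), the lifted bad set has torus
mass `≤ 16(2n+3)⁴ e^{−β^δ}` — uniformly in `L`. [folklore] -/
theorem measureReal_badSet_lagBox_le (r : LatticeRep G) {β δ : ℝ} {n L : ℕ}
    (hL2 : ∀ (x : Site 4) (i j : Fin 4), i < j →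
      wilsonExpectation (L := L + 1) r.ρ β
          (toTorusObservable (L + 1) fun U : LGConfig 4 G =>
            if β ^ (2 * δ - 1) ≤ plaqCostAt r.ρ x i j U then (1 : ℝ) else 0) ≤
        Real.exp (-(β ^ δ))) :
    (wilsonMeasure (d := 4) (L := L + 1) r.ρ β).real
        {U : GaugeConfig 4 (L + 1) G | torusLift (L + 1) U ∈
          ⋃ p ∈ plaquettesTouching (lagBox n),
            {W : LGConfig 4 G | β ^ (2 * δ - 1) < plaqCostAt r.ρ p.1 p.2.1.1 p.2.1.2 W}} ≤
      16 * (2 * (n : ℝ) + 3) ^ 4 * Real.exp (-(β ^ δ)) := by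
  haveI : SecondCountableTopology G := r.secondCountableTopology
  haveI := isProbabilityMeasure_wilsonMeasure (d := 4) (L := L + 1) (G := G) r.ρ r.continuous β
  set μ := wilsonMeasure (d := 4) (L := L + 1) r.ρ β with hμ
  have hset : {U : GaugeConfig 4 (L + 1) G | torusLift (L + 1) U ∈
          ⋃ p ∈ plaquettesTouching (lagBox n),
            {W : LGConfig 4 G | β ^ (2 * δ - 1) < plaqCostAt r.ρ p.1 p.2.1.1 p.2.1.2 W}} =
      ⋃ p ∈ plaquettesTouching (lagBox n),
        {U : GaugeConfig 4 (L + 1) G | β ^ (2 * δ - 1) < plaqCostAt r.ρ p.1 p.2.1.1 p.2.1.2 (torusLift (L + 1) U)} := by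
    ext U
    simp only [Set.mem_setOf_eq, Set.mem_iUnion, exists_prop]
  rw [hset]
  refine (measureReal_biUnion_finset_le _ _).trans ?_
  have hterm : ∀ p ∈ plaquettesTouching (lagBox n),
      μ.real {U : GaugeConfig 4 (L + 1) G | β ^ (2 * δ - 1) < plaqCostAt r.ρ p.1 p.2.1.1 p.2.1.2 (torusLift (L + 1) U)} ≤
        Real.exp (-(β ^ δ)) := by
    intro p _
    calc μ.real {U : GaugeConfig 4 (L + 1) G | β ^ (2 * δ - 1) < plaqCostAt r.ρ p.1 p.2.1.1 p.2.1.2 (torusLift (L + 1) U)}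
        ≤ μ.real {U : GaugeConfig 4 (L + 1) G |
            β ^ (2 * δ - 1) ≤ plaqCostAt r.ρ p.1 p.2.1.1 p.2.1.2 (torusLift (L + 1) U)} :=
          measureReal_mono (fun U (hU : β ^ (2 * δ - 1) < _) => le_of_lt hU)
      _ = _ := measureReal_setOf_le_plaqCostAt_eqG r.ρ r.continuous β _ L p.1 p.2.1.1 p.2.1.2
      _ ≤ Real.exp (-(β ^ δ)) := hL2 p.1 p.2.1.1 p.2.1.2 p.2.2
  refine (Finset.sum_le_sum hterm).trans ?_
  rw [Finset.sum_const, nsmul_eq_mul]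
  exact mul_le_mul_of_nonneg_right (card_plaquettesTouching_lagBox_le n) (Real.exp_pos _).le

end Bad

/-! ### §6. The inner step: one crude-good datum -/

section Inner

variable {G : Type} [Group G] [TopologicalSpace G] [IsTopologicalGroup G] [CompactSpace G]
  [MeasurableSpace G] [BorelSpace G]

/-- **The inner step (one boundary datum whose kernel is cold-typical).**  Let `γ = γ_{Λ_n}(·|η)` be the box kernel and
`ν = γ[|cold]` its cold-conditioned version (`coldKernel`).  If `γ(coldᶜ) ≤ e ≤ 1/2`, the cold floor `θ₀ ≤ Cov_ν(F_R, F_R∘α_R)`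
(`θ₀ ≥ 0`) and the same-datum smoothness `|ν(F_R∘α_R) − ν(F_R)| ≤ ε₀` hold whenever `γ(cold) ≥ 1/2`, then for the UNCONDITIONED kernel
`(1 − e)·θ₀ − 5B²e ≤ Cov_γ(F_R, F_R∘α_R)` and `|γ(F_R∘α_R) − γ(F_R)| ≤ ε₀ + 2Be`, `B = (2R+1)⁴` (§1 with `A = cold`). [folklore] -/
theorem boxKernel_lagCov_ge_of_coldTypical (r : LatticeRep G) {β κ e θ₀ ε₀ : ℝ} {n R : ℕ} {η : LGConfig 4 G}
    (he : ymSpecification (d := 4) r.ρ β (lagBox n) η (coldEvent r β κ (lagBox n))ᶜ ≤ ENNReal.ofReal e)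
    (he0 : 0 ≤ e) (he2 : e ≤ 2⁻¹) (hθ₀ : 0 ≤ θ₀)
    (hfloor : (2 : ENNReal)⁻¹ ≤ ymSpecification (d := 4) r.ρ β (lagBox n) η (coldEvent r β κ (lagBox n)) →
      θ₀ ≤ lagCov (coldKernel r β κ n η) (softLoopObs r R) R)
    (hsmooth : (2 : ENNReal)⁻¹ ≤ ymSpecification (d := 4) r.ρ β (lagBox n) η (coldEvent r β κ (lagBox n)) →
      |condMean r β κ n (fun U => softLoopObs r R (timeShiftLG (G := G) R U)) η -
          condMean r β κ n (softLoopObs r R) η| ≤ ε₀) :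
    (1 - e) * θ₀ - 5 * ((2 * (R : ℝ) + 1) ^ 4) ^ 2 * e ≤
        (∫ W, softLoopObs r R W * softLoopObs r R (timeShiftLG (G := G) R W)
            ∂(ymSpecification (d := 4) r.ρ β (lagBox n) η)) -
          (∫ W, softLoopObs r R W ∂(ymSpecification (d := 4) r.ρ β (lagBox n) η)) *
            ∫ W, softLoopObs r R (timeShiftLG (G := G) R W) ∂(ymSpecification (d := 4) r.ρ β (lagBox n) η) ∧
      |(∫ W, softLoopObs r R (timeShiftLG (G := G) R W) ∂(ymSpecification (d := 4) r.ρ β (lagBox n) η)) -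
          ∫ W, softLoopObs r R W ∂(ymSpecification (d := 4) r.ρ β (lagBox n) η)| ≤
        ε₀ + 2 * (2 * (R : ℝ) + 1) ^ 4 * e := by
  haveI : SecondCountableTopology G := r.secondCountableTopology
  simp only [lagCov, condMean, coldKernel] at hfloor hsmooth
  haveI : IsProbabilityMeasure (ymSpecification (d := 4) r.ρ β (lagBox n) η) :=
    isProbabilityMeasure_ymSpecification r.ρ r.continuous β _ η
  set γ : Measure (LGConfig 4 G) := ymSpecification (d := 4) r.ρ β (lagBox n) η with hγ
  set A : Set (LGConfig 4 G) := coldEvent r β κ (lagBox n) with hAdef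
  have hA : MeasurableSet A := measurableSet_coldEvent r β κ _
  have hAc : γ.real Aᶜ ≤ e := by
    rw [measureReal_def]
    exact ENNReal.toReal_le_of_le_ofReal he0 he
  have hAr : 1 - e ≤ γ.real A := by
    have h := probReal_compl_eq_one_sub (μ := γ) hA
    linarith
  have hA0 : γ A ≠ 0 := by
    intro h0
    have : γ.real A = 0 := by simp [measureReal_def, h0]
    linarith
  have hhalf : (2 : ENNReal)⁻¹ ≤ γ A := by
    rw [← ofReal_measureReal (measure_ne_top γ A)]
    have h2 : (2 : ENNReal)⁻¹ = ENNReal.ofReal (2⁻¹ : ℝ) := by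
      rw [ENNReal.ofReal_inv_of_pos two_pos, ENNReal.ofReal_ofNat]
    rw [h2]
    exact ENNReal.ofReal_le_ofReal (by linarith)
  have hfl := hfloor hhalf
  have hsm := hsmooth hhalf
  set F : LGConfig 4 G → ℝ := softLoopObs r R with hF
  have hFm : Measurable F := (continuous_softLoopObs r R).measurable
  have hGm : Measurable fun U => F (timeShiftLG (G := G) R U) :=
    ((continuous_softLoopObs r R).comp (continuous_timeShiftLG R)).measurable
  have hFB : ∀ U, |F U| ≤ (2 * (R : ℝ) + 1) ^ 4 := abs_softLoopObs_le' r R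
  have hGB : ∀ U, |F (timeShiftLG (G := G) R U)| ≤ (2 * (R : ℝ) + 1) ^ 4 := fun U => abs_softLoopObs_le' r R _
  have key1 : γ.real A * ((∫ W, F W * F (timeShiftLG (G := G) R W) ∂(ProbabilityTheory.cond γ A)) -
        (∫ W, F W ∂(ProbabilityTheory.cond γ A)) * ∫ W, F (timeShiftLG (G := G) R W) ∂(ProbabilityTheory.cond γ A)) -
        5 * ((2 * (R : ℝ) + 1) ^ 4) ^ 2 * e ≤
      (∫ W, F W * F (timeShiftLG (G := G) R W) ∂γ) - (∫ W, F W ∂γ) * ∫ W, F (timeShiftLG (G := G) R W) ∂γ :=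
    measureReal_mul_condCov_sub_le_cov hA hA0 hFm hGm hFB hGB hAc
  have key2 : |(∫ W, F (timeShiftLG (G := G) R W) ∂γ) - ∫ W, F W ∂γ| ≤
      |(∫ W, F (timeShiftLG (G := G) R W) ∂(ProbabilityTheory.cond γ A)) - ∫ W, F W ∂(ProbabilityTheory.cond γ A)| +
        2 * (2 * (R : ℝ) + 1) ^ 4 * e :=
    abs_integral_sub_integral_le_cond hA hA0 hFm hGm hFB hGB hAc
  constructor
  · have h1 : (1 - e) * θ₀ ≤ γ.real A * ((∫ W, F W * F (timeShiftLG (G := G) R W) ∂(ProbabilityTheory.cond γ A)) -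
        (∫ W, F W ∂(ProbabilityTheory.cond γ A)) * ∫ W, F (timeShiftLG (G := G) R W) ∂(ProbabilityTheory.cond γ A)) :=
      mul_le_mul hAr hfl hθ₀ measureReal_nonneg
    linarith
  · exact key2.trans (by linarith)

end Inner

end Summit.QuantumFields.YangMills.Theorems.SoftLoopLongLag

end
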